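import Summits.CriticalPhenomena.PercolationContinuityZ3.Theorems.PercNearOneGluingNoHeavyLowerTailKNGoodGCThreeTwinAffine
import Summits.CriticalPhenomena.PercolationContinuityZ3.Theorems.PercNearOneGluingAdditiveGluingTripleTieRaise
import Literature.Probability.Percolation.KozmaNitzanSeparatingTriple
import HarnessLib

/-!
# Sure twins have the same goodness functional
# (`NoHeavyLowerTail` cell, stmt-CriticalPhenomena-4575; prover `prim-hp-2`, deletion–contraction line, gen 12)

Support file (`--supports stmt-CriticalPhenomena-4575`).  No definitions, no named facts, no sorries.
Memo: `run/shared/lean/prim/prim-hp-2/MEMO-gen12-gc-three-relays.md` §7 (lemma L3 of the assembly plan for the three-relay GC).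

If `s(x,y)` is SURE under `u` then `x` and `y` are almost surely in the same open cluster, hence every term of Kozma–Nitzan's goodness
functional with explicit witness, `agood(u, v; j) = μ_u(v↔b) − μ_u(j↔b) + Σ_{W∩A=∅} μ_u(C(v)=W)·min_a μ_u(a↔b off W)`, is the same for
`v = x` and `v = y`:

* `KNGoodGC3.real_clusterIs_twin` — `μ_u(C(x)=W) = μ_u(C(y)=W)` (the reliabilities agree by the tree's `tripleTie_tau_eq_of_weight_one`);
* `KNGoodGC3.agood_twin_symm` — `agood(u, x; j) = agood(u, y; j)`.
Use (memo §7, phase 2): after the sure hairs of the twin `y` have been moved onto the observer `x` (`agood_update_surePath`), `y` is a sure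
pendant of `x`; reading the functional at `y` instead of `x` puts it in the form of `KNGoodSeriesGlue.agood_wzero_glue_one`, which removes `y`.
[cite: KozmaNitzan2024, §3.2 Definition (p. 12); folklore]
-/

noncomputable section

namespace Summit.CriticalPhenomena.PercolationContinuityZ3.Theorems

open MeasureTheory Set Literature.Probability.LatticeModels Literature.Probability.Percolation
open scoped Classical BigOperators

variable {n : ℕ}

namespace KNGoodGC3

open ChampionStability KNGoodAux KNGoodHair KNGoodSeries KNGoodPortFree

/-- On the sure set of `u` with `u s(x,y) = 1` the twins are joined. [folklore] -/
theorem reachable_twin_of_mem_sureSet (u : Sym2 (Fin n) → unitInterval) {x y : Fin n} (hxy : x ≠ y) (hsure : u s(x, y) = 1)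
    {ω : BondConfig (Fin n)} (hω : ω ∈ KNSep.sureSet u) : (openGraph ω).Reachable x y :=
  ((openGraph_adj ω x y).2 ⟨(hω s(x, y)).2 hsure, hxy⟩).reachable

/-- **Sure twins have the same cluster**: `u s(x,y) = 1 ⇒ μ_u(C(x)=W) = μ_u(C(y)=W)`. [folklore] -/
theorem real_clusterIs_twin (u : Sym2 (Fin n) → unitInterval) {x y : Fin n} (hxy : x ≠ y) (hsure : u s(x, y) = 1)
    (W : Finset (Fin n)) :
    (prodBernoulli u).real (clusterIs x W) = (prodBernoulli u).real (clusterIs y W) := by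
  refine KNSep.real_eq_of_inter_sureSet u ?_
  have key : ∀ ω ∈ KNSep.sureSet u, openCluster ω x = openCluster ω y := by
    intro ω hω
    have hr := reachable_twin_of_mem_sureSet u hxy hsure hω
    ext z
    exact ⟨fun h => (hr.symm.trans h : (openGraph ω).Reachable y z), fun h => (hr.trans h : (openGraph ω).Reachable x z)⟩
  ext ω
  simp only [mem_inter_iff]
  constructor
  · rintro ⟨h, hω⟩
    refine ⟨?_, hω⟩
    rw [mem_clusterIs] at h ⊢
    rw [← key ω hω, h]
  · rintro ⟨h, hω⟩
    refine ⟨?_, hω⟩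
    rw [mem_clusterIs] at h ⊢
    rw [key ω hω, h]

/-- **Sure twins have the same goodness functional**: `u s(x,y) = 1 ⇒ agood(u, x; j) = agood(u, y; j)` for every witness `j`, sink
`b` and relay set `A`. [cite: KozmaNitzan2024, §3.2 Definition (p. 12); folklore] -/
theorem agood_twin_symm (u : Sym2 (Fin n) → unitInterval) (A : Finset (Fin n)) (hA : A.Nonempty) {x y : Fin n} (hxy : x ≠ y)
    (hsure : u s(x, y) = 1) (j b : Fin n) :
    (prodBernoulli u).real (openConn x b) - (prodBernoulli u).real (openConn j b) +
        ∑ W ∈ nullSets A, (prodBernoulli u).real (clusterIs x W) *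
          A.inf' hA (fun a' => (prodBernoulli u).real (openConnIn ((↑W : Set (Fin n))ᶜ) a' b)) =
      (prodBernoulli u).real (openConn y b) - (prodBernoulli u).real (openConn j b) +
        ∑ W ∈ nullSets A, (prodBernoulli u).real (clusterIs y W) *
          A.inf' hA (fun a' => (prodBernoulli u).real (openConnIn ((↑W : Set (Fin n))ᶜ) a' b)) := by
  rw [tripleTie_tau_eq_of_weight_one u hxy hsure b]
  congr 1
  refine Finset.sum_congr rfl fun W _ => ?_
  rw [real_clusterIs_twin u hxy hsure W]

end KNGoodGC3

end Summit.CriticalPhenomena.PercolationContinuityZ3.Theorems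

end
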